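import Summits.Parity.GeneralizedHardyLittlewood.Theorems.Dhl42StaircaseFacts

/-!
# DHL[42,2] certificate — banded thresholds ≤ grade-A thresholds (Remark 5.4, first reduction), F and G sides

`bandF_le_gradeA`, `bandG_le_gradeA`: at the union-grid positions `phiA j` of the 22 grade-A levels,
the band-0 columns of Table 2 are at most the original grade-A thresholds (the banded columns are
band-wise minima). `fin_cases` + `norm_num` on exact rationals.

Origin: the verbatim leg `Dhl42/TpY4Dhl42.lean` of the DHL[42,2] certificate package (pub-dhl42
bundle, archive blob `18cce9e3`; paper snapshot = `paper/main.tex` v1), lines :1218–:1319;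
statements and proofs unchanged except: namespace `TpY4Dhl42` →
`Summit.Parity.GeneralizedHardyLittlewood.Theorems.Dhl42`, the package's `simplexSet n B` replaced
by the tree's definitionally equal `Literature.NumberTheory.Sieve.scaledSimplex n B`
(`PolymathBoundedGaps.lean`), docstrings added where missing.

Declarations (2): `bandF_le_gradeA`, `bandG_le_gradeA`.
-/

namespace Summit.Parity.GeneralizedHardyLittlewood.Theorems.Dhl42

/-! ### The reduction facts: banded ⊆ graded, band monotonicity -/

/-- Banded `tau^F` cells at the grade-A level positions are at most the
grade-A thresholds (the banded columns are band-wise minima; Remark 5.4). -/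
theorem bandF_le_gradeA : ∀ j : Fin 22, tauFband 0 (phiA j) ≤ tauFA j := by
  intro j
  fin_cases j
  · show tauFbandE 0 ⟨5, by norm_num⟩ ≤ tauFA ⟨0, by norm_num⟩
    norm_num [tauFbandE, tauFbandA, tauFA, Matrix.cons_val_two, Matrix.head_cons, Matrix.tail_cons]
  · show tauFbandE 0 ⟨7, by norm_num⟩ ≤ tauFA ⟨1, by norm_num⟩
    norm_num [tauFbandE, tauFbandA, tauFA, Matrix.cons_val_two, Matrix.head_cons, Matrix.tail_cons]
  · show tauFbandE 0 ⟨9, by norm_num⟩ ≤ tauFA ⟨2, by norm_num⟩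
    norm_num [tauFbandE, tauFbandA, tauFA, Matrix.cons_val_two, Matrix.head_cons, Matrix.tail_cons]
  · show tauFbandE 0 ⟨11, by norm_num⟩ ≤ tauFA ⟨3, by norm_num⟩
    norm_num [tauFbandE, tauFbandA, tauFA, Matrix.cons_val_two, Matrix.head_cons, Matrix.tail_cons]
  · show tauFbandE 0 ⟨13, by norm_num⟩ ≤ tauFA ⟨4, by norm_num⟩
    norm_num [tauFbandE, tauFbandA, tauFA, Matrix.cons_val_two, Matrix.head_cons, Matrix.tail_cons]
  · show tauFbandE 0 ⟨15, by norm_num⟩ ≤ tauFA ⟨5, by norm_num⟩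
    norm_num [tauFbandE, tauFbandA, tauFA, Matrix.cons_val_two, Matrix.head_cons, Matrix.tail_cons]
  · show tauFbandE 0 ⟨17, by norm_num⟩ ≤ tauFA ⟨6, by norm_num⟩
    norm_num [tauFbandE, tauFbandA, tauFA, Matrix.cons_val_two, Matrix.head_cons, Matrix.tail_cons]
  · show tauFbandE 0 ⟨18, by norm_num⟩ ≤ tauFA ⟨7, by norm_num⟩
    norm_num [tauFbandE, tauFbandA, tauFA, Matrix.cons_val_two, Matrix.head_cons, Matrix.tail_cons]
  · show tauFbandE 0 ⟨20, by norm_num⟩ ≤ tauFA ⟨8, by norm_num⟩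
    norm_num [tauFbandE, tauFbandA, tauFA, Matrix.cons_val_two, Matrix.head_cons, Matrix.tail_cons]
  · show tauFbandE 0 ⟨22, by norm_num⟩ ≤ tauFA ⟨9, by norm_num⟩
    norm_num [tauFbandE, tauFbandA, tauFA, Matrix.cons_val_two, Matrix.head_cons, Matrix.tail_cons]
  · show tauFbandE 0 ⟨24, by norm_num⟩ ≤ tauFA ⟨10, by norm_num⟩
    norm_num [tauFbandE, tauFbandA, tauFA, Matrix.cons_val_two, Matrix.head_cons, Matrix.tail_cons]
  · show tauFbandE 0 ⟨27, by norm_num⟩ ≤ tauFA ⟨11, by norm_num⟩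
    norm_num [tauFbandE, tauFbandA, tauFA, Matrix.cons_val_two, Matrix.head_cons, Matrix.tail_cons]
  · show tauFbandE 0 ⟨30, by norm_num⟩ ≤ tauFA ⟨12, by norm_num⟩
    norm_num [tauFbandE, tauFbandA, tauFA, Matrix.cons_val_two, Matrix.head_cons, Matrix.tail_cons]
  · show tauFbandE 0 ⟨33, by norm_num⟩ ≤ tauFA ⟨13, by norm_num⟩
    norm_num [tauFbandE, tauFbandA, tauFA, Matrix.cons_val_two, Matrix.head_cons, Matrix.tail_cons]
  · show tauFbandE 0 ⟨36, by norm_num⟩ ≤ tauFA ⟨14, by norm_num⟩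
    norm_num [tauFbandE, tauFbandA, tauFA, Matrix.cons_val_two, Matrix.head_cons, Matrix.tail_cons]
  · show tauFbandE 0 ⟨39, by norm_num⟩ ≤ tauFA ⟨15, by norm_num⟩
    norm_num [tauFbandE, tauFbandA, tauFA, Matrix.cons_val_two, Matrix.head_cons, Matrix.tail_cons]
  · show tauFbandE 0 ⟨42, by norm_num⟩ ≤ tauFA ⟨16, by norm_num⟩
    norm_num [tauFbandE, tauFbandA, tauFA, Matrix.cons_val_two, Matrix.head_cons, Matrix.tail_cons]
  · show tauFbandE 0 ⟨44, by norm_num⟩ ≤ tauFA ⟨17, by norm_num⟩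
    norm_num [tauFbandE, tauFbandA, tauFA, Matrix.cons_val_two, Matrix.head_cons, Matrix.tail_cons]
  · show tauFbandE 0 ⟨46, by norm_num⟩ ≤ tauFA ⟨18, by norm_num⟩
    norm_num [tauFbandE, tauFbandA, tauFA, Matrix.cons_val_two, Matrix.head_cons, Matrix.tail_cons]
  · show tauFbandE 0 ⟨48, by norm_num⟩ ≤ tauFA ⟨19, by norm_num⟩
    norm_num [tauFbandE, tauFbandA, tauFA, Matrix.cons_val_two, Matrix.head_cons, Matrix.tail_cons]
  · show tauFbandE 0 ⟨50, by norm_num⟩ ≤ tauFA ⟨20, by norm_num⟩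
    norm_num [tauFbandE, tauFbandA, tauFA, Matrix.cons_val_two, Matrix.head_cons, Matrix.tail_cons]
  · show tauFbandE 0 ⟨52, by norm_num⟩ ≤ tauFA ⟨21, by norm_num⟩
    norm_num [tauFbandE, tauFbandA, tauFA, Matrix.cons_val_two, Matrix.head_cons, Matrix.tail_cons]

/-- Banded `tau^G` cells at the grade-A level positions are at most the
grade-A thresholds (the banded columns are band-wise minima; Remark 5.4). -/
theorem bandG_le_gradeA : ∀ j : Fin 22, tauGband 0 (phiA j) ≤ tauGA j := by
  intro j
  fin_cases j
  · show tauGbandE 0 ⟨5, by norm_num⟩ ≤ tauGA ⟨0, by norm_num⟩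
    norm_num [tauGbandE, tauGbandA, tauGA, Matrix.cons_val_two, Matrix.head_cons, Matrix.tail_cons]
  · show tauGbandE 0 ⟨7, by norm_num⟩ ≤ tauGA ⟨1, by norm_num⟩
    norm_num [tauGbandE, tauGbandA, tauGA, Matrix.cons_val_two, Matrix.head_cons, Matrix.tail_cons]
  · show tauGbandE 0 ⟨9, by norm_num⟩ ≤ tauGA ⟨2, by norm_num⟩
    norm_num [tauGbandE, tauGbandA, tauGA, Matrix.cons_val_two, Matrix.head_cons, Matrix.tail_cons]
  · show tauGbandE 0 ⟨11, by norm_num⟩ ≤ tauGA ⟨3, by norm_num⟩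
    norm_num [tauGbandE, tauGbandA, tauGA, Matrix.cons_val_two, Matrix.head_cons, Matrix.tail_cons]
  · show tauGbandE 0 ⟨13, by norm_num⟩ ≤ tauGA ⟨4, by norm_num⟩
    norm_num [tauGbandE, tauGbandA, tauGA, Matrix.cons_val_two, Matrix.head_cons, Matrix.tail_cons]
  · show tauGbandE 0 ⟨15, by norm_num⟩ ≤ tauGA ⟨5, by norm_num⟩
    norm_num [tauGbandE, tauGbandA, tauGA, Matrix.cons_val_two, Matrix.head_cons, Matrix.tail_cons]
  · show tauGbandE 0 ⟨17, by norm_num⟩ ≤ tauGA ⟨6, by norm_num⟩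
    norm_num [tauGbandE, tauGbandA, tauGA, Matrix.cons_val_two, Matrix.head_cons, Matrix.tail_cons]
  · show tauGbandE 0 ⟨18, by norm_num⟩ ≤ tauGA ⟨7, by norm_num⟩
    norm_num [tauGbandE, tauGbandA, tauGA, Matrix.cons_val_two, Matrix.head_cons, Matrix.tail_cons]
  · show tauGbandE 0 ⟨20, by norm_num⟩ ≤ tauGA ⟨8, by norm_num⟩
    norm_num [tauGbandE, tauGbandA, tauGA, Matrix.cons_val_two, Matrix.head_cons, Matrix.tail_cons]
  · show tauGbandE 0 ⟨22, by norm_num⟩ ≤ tauGA ⟨9, by norm_num⟩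
    norm_num [tauGbandE, tauGbandA, tauGA, Matrix.cons_val_two, Matrix.head_cons, Matrix.tail_cons]
  · show tauGbandE 0 ⟨24, by norm_num⟩ ≤ tauGA ⟨10, by norm_num⟩
    norm_num [tauGbandE, tauGbandA, tauGA, Matrix.cons_val_two, Matrix.head_cons, Matrix.tail_cons]
  · show tauGbandE 0 ⟨27, by norm_num⟩ ≤ tauGA ⟨11, by norm_num⟩
    norm_num [tauGbandE, tauGbandA, tauGA, Matrix.cons_val_two, Matrix.head_cons, Matrix.tail_cons]
  · show tauGbandE 0 ⟨30, by norm_num⟩ ≤ tauGA ⟨12, by norm_num⟩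
    norm_num [tauGbandE, tauGbandA, tauGA, Matrix.cons_val_two, Matrix.head_cons, Matrix.tail_cons]
  · show tauGbandE 0 ⟨33, by norm_num⟩ ≤ tauGA ⟨13, by norm_num⟩
    norm_num [tauGbandE, tauGbandA, tauGA, Matrix.cons_val_two, Matrix.head_cons, Matrix.tail_cons]
  · show tauGbandE 0 ⟨36, by norm_num⟩ ≤ tauGA ⟨14, by norm_num⟩
    norm_num [tauGbandE, tauGbandA, tauGA, Matrix.cons_val_two, Matrix.head_cons, Matrix.tail_cons]
  · show tauGbandE 0 ⟨39, by norm_num⟩ ≤ tauGA ⟨15, by norm_num⟩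
    norm_num [tauGbandE, tauGbandA, tauGA, Matrix.cons_val_two, Matrix.head_cons, Matrix.tail_cons]
  · show tauGbandE 0 ⟨42, by norm_num⟩ ≤ tauGA ⟨16, by norm_num⟩
    norm_num [tauGbandE, tauGbandA, tauGA, Matrix.cons_val_two, Matrix.head_cons, Matrix.tail_cons]
  · show tauGbandE 0 ⟨44, by norm_num⟩ ≤ tauGA ⟨17, by norm_num⟩
    norm_num [tauGbandE, tauGbandA, tauGA, Matrix.cons_val_two, Matrix.head_cons, Matrix.tail_cons]
  · show tauGbandE 0 ⟨46, by norm_num⟩ ≤ tauGA ⟨18, by norm_num⟩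
    norm_num [tauGbandE, tauGbandA, tauGA, Matrix.cons_val_two, Matrix.head_cons, Matrix.tail_cons]
  · show tauGbandE 0 ⟨48, by norm_num⟩ ≤ tauGA ⟨19, by norm_num⟩
    norm_num [tauGbandE, tauGbandA, tauGA, Matrix.cons_val_two, Matrix.head_cons, Matrix.tail_cons]
  · show tauGbandE 0 ⟨50, by norm_num⟩ ≤ tauGA ⟨20, by norm_num⟩
    norm_num [tauGbandE, tauGbandA, tauGA, Matrix.cons_val_two, Matrix.head_cons, Matrix.tail_cons]
  · show tauGbandE 0 ⟨52, by norm_num⟩ ≤ tauGA ⟨21, by norm_num⟩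
    norm_num [tauGbandE, tauGbandA, tauGA, Matrix.cons_val_two, Matrix.head_cons, Matrix.tail_cons]

end Summit.Parity.GeneralizedHardyLittlewood.Theorems.Dhl42
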